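import Literature.Topology.FourManifolds.SphereFamilySurgery
import Literature.Topology.FourManifolds.UnorientedDiscTheorem
import Literature.Topology.FourManifolds.DiscTheoremSupport
import Literature.Topology.FourManifolds.AnnulusPairConnectivity
import Literature.Topology.FourManifolds.ConnectedSumSphereIdentity
import Literature.Topology.FourManifolds.OrientedConnectedSumTransportProofs
import Literature.Topology.FourManifolds.ClosedBallSmoothMaps
import Literature.Topology.FourManifolds.CollarShrink
import HarnessLib

/-!
# Normalisation of a `0`-surgery along a framed `S⁰` in a connected `3`-manifold: the two feet
# may be moved onto any two prescribed disjoint discs, up to one reflection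

Topic `Literature/Topology/FourManifolds`; the DISC-THEOREM half of piece (2) of the roadmap of
`OneHandlebodyBoundarySum.lean` (the one-handle step `isConnectedSum_boundary_of_isHandleAttachment_one`:
`0`-surgery along a framed `S⁰` in a connected `3`-manifold with orientable result is `· # (S² × S¹)`),
consumed by `ZeroSphereSurgeryConnectedSum.lean`.

**Theorem** (`FramedSphereFamily.IsSurgery.exists_isOpenGluing_stdRel`).  Let `Z` be a connected
Hausdorff smooth `3`-manifold, `νS : S⁰ × ℝ³ ↪ Z` a framed `0`-sphere (`FramedSphereFamily (𝓡 3) Z Unit 0 3`)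
and `Z₂` the surgery of `Z` along it (`νS.IsSurgery (𝓡 3) Z₂`: the open gluing of `Z ∖ {two feet}`
and `D̊¹ × S²` along Milnor's identification `νS (±e₁, t u) ∼ (±t e₁, u)`).  Then for ANY two discs
`D₊, D₋ : ℝ³ ↪ Z` with disjoint ranges, `Z₂` is still the open gluing of `Z ∖ {D₊ 0, D₋ 0}` and
`D̊¹ × S²` along the same identification written with `D₊` and `D₋ ∘ r` in place of the two feet,
for `r` either the identity or ONE fixed reflection of `ℝ³` (`det r < 0`).  Proof: the unoriented
disc theorem with compact support (Palais 1960 / Hirsch 1976, Ch. 8 §3, Thm. 3.1 and the remark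
after it; `exists_diffeomorph_apply_disc_eq_or_reflect_cs`) moves the foot `νS(e₁, ·)` onto `D₊`
or `D₊ ∘ r` by a diffeomorphism `f₁` of `Z`, then — applied in the connected open submanifold
`Z ∖ D₊(𝔻³)` and extended by the identity (`OpensDiffeoExtension.exists_diffeomorph_extend`) —
the foot `f₁ ∘ νS(-e₁, ·)` onto `D₋` or `D₋ ∘ r` by `f₂` fixing `D₊(𝔻³)`; the surgery presentation
is transported along `F = f₂ ∘ f₁` (`IsOpenGluing.comp_diffeomorph_pieces`), and a reflection on
the `+` side is absorbed into the new piece by the symmetry `(y, u) ↦ (y, r u)` of `D̊¹ × S²`.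
Everything here is proved; no definitions and no named facts are introduced.

## References

* R. Palais, *Extending diffeomorphisms*, Proc. AMS 11 (1960), Thm. B. [Palais1960]
* M. W. Hirsch, *Differential Topology* (1976), Ch. 8 §1 Thm. 1.3, §3 Thm. 3.1. [HirschDT1976]
* A. A. Kosinski, *Differential Manifolds* (1993), III (3.6), VI §1 and §9. [Kosinski1993]
-/

open scoped Manifold ContDiff Topology
open Set Function Filter Metric

noncomputable section

namespace Literature.Topology.FourManifolds

universe u v

/-! ### §0.1 The `0`-sphere `S⁰ ⊂ ℝ¹` has two points -/

/-- The unit vector `e₁` of `ℝ¹` lies on `S⁰`. [folklore] -/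
theorem single_mem_sphere_zero :
    (EuclideanSpace.single (0 : Fin 1) (1 : ℝ)) ∈ Metric.sphere (0 : EuclideanSpace ℝ (Fin 1)) 1 := by
  rw [mem_sphere_zero_iff_norm, PiLp.norm_single, norm_one]

/-- The vector `-e₁` of `ℝ¹` lies on `S⁰`. [folklore] -/
theorem neg_single_mem_sphere_zero :
    (-EuclideanSpace.single (0 : Fin 1) (1 : ℝ)) ∈ Metric.sphere (0 : EuclideanSpace ℝ (Fin 1)) 1 := by
  rw [mem_sphere_zero_iff_norm, norm_neg, PiLp.norm_single, norm_one]

/-- **`S⁰ = {e₁, -e₁}`**: a unit vector of `ℝ¹` is `e₁` or `-e₁`. [folklore] -/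
theorem sphere_zero_eq_or (v : Metric.sphere (0 : EuclideanSpace ℝ (Fin 1)) 1) :
    v = ⟨EuclideanSpace.single (0 : Fin 1) (1 : ℝ), single_mem_sphere_zero⟩ ∨
      v = ⟨-EuclideanSpace.single (0 : Fin 1) (1 : ℝ), neg_single_mem_sphere_zero⟩ := by
  have hv : ‖(v : EuclideanSpace ℝ (Fin 1))‖ = 1 := norm_eq_of_mem_sphere v
  rw [EuclideanSpace.norm_eq, Fin.sum_univ_one, Real.sqrt_eq_one, Real.norm_eq_abs, sq_abs,
    sq_eq_one_iff] at hv
  rcases hv with h | h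
  · left
    apply Subtype.ext
    ext i
    rw [Subsingleton.elim i 0, h]
    simp
  · right
    apply Subtype.ext
    ext i
    rw [Subsingleton.elim i 0, PiLp.neg_apply, h]
    simp

/-! ### §0.2 Extension by the identity of a compactly supported diffeomorphism of an open submanifold -/

namespace OpensDiffeoExtension

variable {E H : Type*} [NormedAddCommGroup E] [NormedSpace ℝ E] [TopologicalSpace H]
  {I : ModelWithCorners ℝ E H} {M : Type*} [TopologicalSpace M] [ChartedSpace H M]
  (U : TopologicalSpace.Opens M)

/-- The extension by the identity `Function.extend val (val ∘ f) id` of a self-map `f` of an open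
subset agrees with `f` on the subset. [folklore] -/
theorem extend_apply_coe (f : U → U) (x : U) :
    Function.extend (Subtype.val : U → M) (Subtype.val ∘ f) id (x : M) = f x :=
  Subtype.val_injective.extend_apply _ _ x

/-- Off `U` the extension is the identity. [folklore] -/
theorem extend_apply_of_not_mem (f : U → U) {p : M} (hp : p ∉ U) :
    Function.extend (Subtype.val : U → M) (Subtype.val ∘ f) id p = p :=
  Function.extend_apply' _ _ p fun ⟨x, hx⟩ => hp (hx ▸ x.2)

/-- Off `val '' K` the extension of a map supported in `K` is the identity. [folklore] -/
theorem extend_eq_self {f : U → U} {K : Set U} (hf : ∀ x ∉ K, f x = x) {p : M}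
    (hp : p ∉ Subtype.val '' K) :
    Function.extend (Subtype.val : U → M) (Subtype.val ∘ f) id p = p := by
  by_cases h : p ∈ U
  · have hx : (⟨p, h⟩ : U) ∉ K := fun hK => hp ⟨_, hK, rfl⟩
    rw [show p = ((⟨p, h⟩ : U) : M) from rfl, extend_apply_coe U f, hf _ hx]
  · exact extend_apply_of_not_mem U f h

/-- Extensions of mutually inverse maps are mutually inverse. [folklore] -/
theorem extend_extend {f g : U → U} (hgf : ∀ x, g (f x) = x) (p : M) :
    Function.extend (Subtype.val : U → M) (Subtype.val ∘ g) id
      (Function.extend (Subtype.val : U → M) (Subtype.val ∘ f) id p) = p := by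
  by_cases h : p ∈ U
  · rw [show p = ((⟨p, h⟩ : U) : M) from rfl, extend_apply_coe U f, extend_apply_coe U g, hgf]
  · rw [extend_apply_of_not_mem U f h, extend_apply_of_not_mem U g h]

/-- **The extension by the identity of a `C^∞` self-map of an open submanifold with compact support
is `C^∞`** (`M` Hausdorff): near `val '' K` it is `val ∘ f ∘ val⁻¹` on the open `U`, elsewhere the
identity near the point. [folklore] -/
theorem contMDiff_extend [T2Space M] {f : U → U} (hfs : ContMDiff I I ∞ f) {K : Set U}
    (hK : IsCompact K) (hf : ∀ x ∉ K, f x = x) :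
    ContMDiff I I ∞ (Function.extend (Subtype.val : U → M) (Subtype.val ∘ f) id) := by
  classical
  intro p
  have hKc : IsClosed (Subtype.val '' K) := (hK.image continuous_subtype_val).isClosed
  by_cases hp : p ∈ Subtype.val '' K
  · -- `p ∈ U`: work on the open `U` with the retraction `q ↦ ⟨q, _⟩`
    obtain ⟨x, hxK, rfl⟩ := hp
    have hU : (U : Set M) ∈ 𝓝 (x : M) := U.isOpen.mem_nhds x.2
    set ret : M → U := fun q => if h : q ∈ U then ⟨q, h⟩ else x with hret
    have hret_val : ∀ q ∈ (U : Set M), ((ret q : U) : M) = q := fun q hq => by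
      have hq' : q ∈ U := hq
      rw [hret]
      dsimp only
      rw [dif_pos hq']
    have hrets : ContMDiffOn I I ∞ ret U := by
      intro q hq
      rw [← ContMDiffWithinAt.subtypeVal_comp_iff]
      exact contMDiffWithinAt_id.congr (fun q' hq' => hret_val q' hq') (hret_val q hq)
    have h1 : ContMDiffOn I I ∞ (Subtype.val ∘ f ∘ ret) U :=
      (contMDiff_subtype_val.comp hfs).comp_contMDiffOn hrets
    have h2 : ContMDiffOn I I ∞ (Function.extend (Subtype.val : U → M) (Subtype.val ∘ f) id) U := by
      refine h1.congr fun q hq => ?_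
      have hq' : q = ((ret q : U) : M) := (hret_val q hq).symm
      conv_lhs => rw [hq']
      rw [extend_apply_coe U f]
      rfl
    exact h2.contMDiffAt hU
  · -- off the support: the identity near `p`
    have hev : Function.extend (Subtype.val : U → M) (Subtype.val ∘ f) id =ᶠ[𝓝 p] id := by
      filter_upwards [hKc.isOpen_compl.mem_nhds hp] with q hq
      exact extend_eq_self U hf hq
    exact contMDiffAt_id.congr_of_eventuallyEq hev

/-- **Extension by the identity of a compactly supported diffeomorphism of an open submanifold**
(Hirsch, *Differential Topology* (1976), Ch. 8 §1, Thm. 1.3, and §3, proof of Thm. 3.1, static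
form): a diffeomorphism `f` of an open submanifold `U` of a Hausdorff manifold `M`, equal to the
identity outside a compact set `K ⊆ U`, extends to a diffeomorphism `F` of `M` with `F ∘ val = val ∘ f`
and `F = id` off `val '' K`. [cite: HirschDT1976, Ch. 8 §1 Thm. 1.3] -/
theorem exists_diffeomorph_extend [T2Space M] (f : U ≃ₘ⟮I, I⟯ U) {K : Set U} (hK : IsCompact K)
    (hf : ∀ x ∉ K, f x = x) :
    ∃ F : M ≃ₘ⟮I, I⟯ M, (∀ x : U, F x = f x) ∧ ∀ p ∉ Subtype.val '' K, F p = p := by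
  have hf' : ∀ x ∉ K, f.symm x = x := fun x hx => by
    conv_lhs => rw [← hf x hx]
    exact f.symm_apply_apply x
  exact ⟨{ toFun := Function.extend (Subtype.val : U → M) (Subtype.val ∘ f) id
           invFun := Function.extend (Subtype.val : U → M) (Subtype.val ∘ f.symm) id
           left_inv := extend_extend U f.symm_apply_apply
           right_inv := extend_extend U f.apply_symm_apply
           contMDiff_toFun := contMDiff_extend U f.contMDiff hK hf
           contMDiff_invFun := contMDiff_extend U f.symm.contMDiff hK hf' },
    fun x => extend_apply_coe U f x, fun p hp => extend_eq_self U hf hp⟩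

end OpensDiffeoExtension

/-! ### §0.3 The complement of a closed embedded ball in a connected manifold is connected -/

/-- **Ball-complement criterion** (the ball version of `isPreconnected_compl_singleton_of_puncturedNhd`):
in a preconnected space `X`, if the closed set `C` has an open neighbourhood `U` with `U ∖ C` nonempty
and preconnected, then `X ∖ C` is preconnected — a separation `X ∖ C = u ⊔ v` with `U ∖ C ⊆ u` would
give the separation `X = (u ∪ U) ⊔ v` of `X`. [folklore] -/
theorem isPreconnected_compl_of_nhd {X : Type*} [TopologicalSpace X] [PreconnectedSpace X]
    {C U : Set X} (hC : IsClosed C) (hU : IsOpen U) (hCU : C ⊆ U) (hS : IsPreconnected (U \ C))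
    (hne : (U \ C).Nonempty) : IsPreconnected (Cᶜ : Set X) := by
  -- the one-sided statement, for separating sets avoiding `C`
  have key : ∀ u v : Set X, IsOpen u → IsOpen v → Cᶜ ⊆ u ∪ v → Disjoint u v → v ⊆ Cᶜ →
      U \ C ⊆ u → Cᶜ ⊆ u := by
    intro u v hu hv huv hdisj hvC hUu
    have hcovX : (univ : Set X) ⊆ (u ∪ U) ∪ v := fun y _ => by
      by_cases hyC : y ∈ C
      · exact Or.inl (Or.inr (hCU hyC))
      · exact (huv hyC).elim (fun h => Or.inl (Or.inl h)) Or.inr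
    have hdisjX : Disjoint (u ∪ U) v := by
      rw [Set.disjoint_union_left]
      refine ⟨hdisj, Set.disjoint_left.2 fun y hyU hyv => ?_⟩
      exact Set.disjoint_left.1 hdisj (hUu ⟨hyU, hvC hyv⟩) hyv
    rcases isPreconnected_univ.subset_or_subset (hu.union hU) hv hdisjX hcovX with h | h
    · intro y hyC
      rcases h (mem_univ y) with hyu | hyU
      · exact hyu
      · exact hUu ⟨hyU, hyC⟩
    · exfalso
      obtain ⟨y, hy⟩ := hne
      exact Set.disjoint_left.1 hdisj (hUu hy) (h (mem_univ y))
  rw [isPreconnected_iff_subset_of_disjoint]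
  intro u v hu hv huv hdisj
  -- puncture the separating sets
  have hu'o : IsOpen (u ∩ Cᶜ) := hu.inter hC.isOpen_compl
  have hv'o : IsOpen (v ∩ Cᶜ) := hv.inter hC.isOpen_compl
  have hcov' : Cᶜ ⊆ u ∩ Cᶜ ∪ v ∩ Cᶜ := fun y hy =>
    (huv hy).elim (fun h => Or.inl ⟨h, hy⟩) fun h => Or.inr ⟨h, hy⟩
  have hdisj' : Disjoint (u ∩ Cᶜ) (v ∩ Cᶜ) := Set.disjoint_left.2 fun y hyu hyv => by
    have : y ∈ Cᶜ ∩ (u ∩ v) := ⟨hyu.2, hyu.1, hyv.1⟩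
    rw [hdisj] at this
    exact this
  have hUC : U \ C ⊆ u ∩ Cᶜ ∨ U \ C ⊆ v ∩ Cᶜ :=
    (isPreconnected_iff_subset_of_disjoint.1 hS) _ _ hu'o hv'o (fun y hy => hcov' hy.2)
      (by rw [Set.disjoint_iff_inter_eq_empty.1 hdisj', inter_empty])
  rcases hUC with h | h
  · exact Or.inl ((key _ _ hu'o hv'o hcov' hdisj' inter_subset_right h).trans inter_subset_left)
  · refine Or.inr ((key _ _ hv'o hu'o ?_ hdisj'.symm inter_subset_right h).trans inter_subset_left)
    rwa [union_comm]

/-- **The complement of a closed disc `D(𝔻ⁿ)` of a disc `D : ℝⁿ ↪ X` in a connected Hausdorff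
`n`-manifold, `n ≥ 2`, is a connected open submanifold**: the punctured chart `D(ℝⁿ ∖ 𝔻ⁿ)` is
connected (`isConnected_image_compl_closedBall`) and the ball-complement criterion applies.
[folklore] -/
theorem connectedSpace_compl_image_closedBall {n : ℕ} {X : Type*} [TopologicalSpace X] [T2Space X]
    [ConnectedSpace X] {D : EuclideanSpace ℝ (Fin n) → X} (hD : Topology.IsOpenEmbedding D) (hn : 2 ≤ n)
    (U : TopologicalSpace.Opens X) (hU : (U : Set X) = (D '' Metric.closedBall 0 1)ᶜ) :
    ConnectedSpace U := by
  have hC : IsClosed (D '' Metric.closedBall (0 : EuclideanSpace ℝ (Fin n)) 1) :=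
    ((isCompact_closedBall _ _).image hD.continuous).isClosed
  have hdiff : range D \ D '' Metric.closedBall 0 1 = D '' (Metric.closedBall 0 1)ᶜ := by
    rw [← image_univ, ← image_sdiff hD.injective, compl_eq_univ_sdiff]
  have hconn := isConnected_image_compl_closedBall hD hn 1
  have hpre : IsPreconnected ((D '' Metric.closedBall (0 : EuclideanSpace ℝ (Fin n)) 1)ᶜ) :=
    isPreconnected_compl_of_nhd hC hD.isOpen_range (image_subset_range _ _)
      (by rw [hdiff]; exact hconn.isPreconnected) (by rw [hdiff]; exact hconn.nonempty)
  have hne : ((D '' Metric.closedBall (0 : EuclideanSpace ℝ (Fin n)) 1)ᶜ).Nonempty := by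
    obtain ⟨y, hy⟩ := hconn.nonempty
    rw [← hdiff] at hy
    exact ⟨y, hy.2⟩
  have h : IsConnected ((U : Set X)) := by rw [hU]; exact ⟨hne, hpre⟩
  exact isConnected_iff_connectedSpace.1 h

/-! ### §0.4 The feet of a framed `S⁰` are discs -/

/-- **`S⁰` is finite** (it is `{e₁, -e₁}`; a private copy of the tree's lemma of the same name in
`HCobordismIdealCircleLemma83Complement.lean`, to keep the imports light). [folklore] -/
private theorem sphere_zero_finite : (Metric.sphere (0 : EuclideanSpace ℝ (Fin 1)) 1).Finite :=
  (Set.toFinite {EuclideanSpace.single (0 : Fin 1) (1 : ℝ), -EuclideanSpace.single (0 : Fin 1) (1 : ℝ)}).subset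
    fun w hw => by
      rcases sphere_zero_eq_or ⟨w, hw⟩ with h | h
      · exact Or.inl (congrArg Subtype.val h)
      · exact Or.inr (congrArg Subtype.val h)

/-- **The slices `y ↦ ν (v, y)` of a framed `S⁰`-family are discs**: each is a `C^∞` embedding
`ℝᵐ ↪ X` with open range (the slice `{v} × ℝᵐ` is open in `S⁰ × ℝᵐ` as `S⁰` is discrete, and the
inverse `pr₂ ∘ ν⁻¹` is smooth on the range, `contMDiffOn_symm_of_isSmoothEmbedding`). [folklore] -/
theorem FramedSphereFamily.isSmoothEmbedding_slice {m : ℕ} {X : Type*} [TopologicalSpace X]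
    [ChartedSpace (EuclideanSpace ℝ (Fin m)) X] [IsManifold (𝓡 m) ∞ X] {ι : Type u}
    (ν : FramedSphereFamily (𝓡 m) X ι 0 m) (i : ι)
    (v : Metric.sphere (0 : EuclideanSpace ℝ (Fin 1)) 1) :
    Manifold.IsSmoothEmbedding (𝓡 m) (𝓡 m) ∞ (fun y : EuclideanSpace ℝ (Fin m) => ν.toFun i (v, y)) ∧
      IsOpen (range fun y : EuclideanSpace ℝ (Fin m) => ν.toFun i (v, y)) := by
  haveI : Finite (Metric.sphere (0 : EuclideanSpace ℝ (Fin 1)) 1) := sphere_zero_finite.to_subtype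
  haveI : Nonempty (Metric.sphere (0 : EuclideanSpace ℝ (Fin 1)) 1) := ⟨v⟩
  set T : EuclideanSpace ℝ (Fin m) → X := fun y => ν.toFun i (v, y) with hT
  have hνoe : Topology.IsOpenEmbedding (ν.toFun i) :=
    ⟨(ν.isSmoothEmbedding i).isEmbedding, ν.isOpen_range i⟩
  have hsl : Topology.IsOpenEmbedding
      (Prod.mk v : EuclideanSpace ℝ (Fin m) → (Metric.sphere (0 : EuclideanSpace ℝ (Fin 1)) 1) ×
        EuclideanSpace ℝ (Fin m)) := by
    refine ⟨isEmbedding_prodMkRight v, ?_⟩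
    have : range (Prod.mk v : EuclideanSpace ℝ (Fin m) →
        (Metric.sphere (0 : EuclideanSpace ℝ (Fin 1)) 1) × EuclideanSpace ℝ (Fin m)) = Prod.fst ⁻¹' {v} := by
      ext ⟨a, b⟩
      simp only [mem_range, Prod.mk.injEq, mem_preimage, mem_singleton_iff]
      exact ⟨fun ⟨y, h1, _⟩ => h1.symm, fun h => ⟨b, h.symm, rfl⟩⟩
    rw [this]
    exact (isOpen_discrete _).preimage continuous_fst
  have hToe : Topology.IsOpenEmbedding T := hνoe.comp hsl
  refine ⟨?_, hToe.isOpen_range⟩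
  have hTs : ContMDiff (𝓡 m) (𝓡 m) ∞ T :=
    (ν.contMDiff i).comp (contMDiff_const.prodMk contMDiff_id)
  -- the inverse `pr₂ ∘ ν⁻¹` is smooth on the range
  have hgs : ContMDiffOn (𝓡 m) (𝓡 m) ∞
      (fun z => ((hνoe.toOpenPartialHomeomorph (ν.toFun i)).symm z).2) (range T) :=
    (contMDiff_snd.comp_contMDiffOn
      (contMDiffOn_symm_of_isSmoothEmbedding (ν.isSmoothEmbedding i) hνoe)).mono
      (by rintro _ ⟨y, rfl⟩; exact ⟨(v, y), rfl⟩)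
  have hsymm : ContMDiffOn (𝓡 m) (𝓡 m) ∞ (hToe.toOpenPartialHomeomorph T).symm
      (hToe.toOpenPartialHomeomorph T).target := by
    rw [hToe.toOpenPartialHomeomorph_target]
    refine hgs.congr fun z hz => ?_
    obtain ⟨y, rfl⟩ := hz
    rw [hToe.toOpenPartialHomeomorph_left_inv]
    have h2 : (hνoe.toOpenPartialHomeomorph (ν.toFun i)).symm (T y) = (v, y) :=
      hνoe.toOpenPartialHomeomorph_left_inv
    rw [h2]
  exact isSmoothEmbedding_of_openPartialHomeomorph (I := 𝓡 m) (J := 𝓡 m) (n := ∞)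
    (hToe.toOpenPartialHomeomorph T) hToe.toOpenPartialHomeomorph_source
    (by rw [hToe.toOpenPartialHomeomorph_source]; exact hTs.contMDiffOn) hsymm
    (ContinuousLinearEquiv.refl ℝ (EuclideanSpace ℝ (Fin m)))

/-! ### §1 Normalisation of the surgery presentation -/

/-- **Transport step.**  If a diffeomorphism `F` of `Z` takes the feet `T₊ ∘ ρ₊`, `T₋ ∘ ρ₋` of the
framed `S⁰` (precomposed with linear isometries `ρ±` of `ℝ³`, `ρ₋` involutive) onto the discs `D₊`, `D₋`
on the closed unit ball, then the surgery `Z₂` of `Z` along the framed `S⁰` is the open gluing of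
`Z ∖ {D₊ 0, D₋ 0}` and `D̊¹ × S²` along Milnor's identification written with `D₊` and
`D₋ ∘ ρ₋ ∘ ρ₊` (`IsOpenGluing.comp_diffeomorph_pieces` along `F⁻¹` on the first piece and the
symmetry `(y, u) ↦ (y, ρ₊ u)` of the new piece). [cite: MilnorHCobordism1965, Def. 3.11] -/
theorem FramedSphereFamily.IsSurgery.isOpenGluing_stdRel_of_diffeomorph
    {Z : Type u} [TopologicalSpace Z] [T2Space Z]
    [ChartedSpace (EuclideanSpace ℝ (Fin 3)) Z] [IsManifold (𝓡 3) ∞ Z]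
    {νS : FramedSphereFamily (𝓡 3) Z Unit 0 3}
    {Z₂ : Type v} [TopologicalSpace Z₂] [ChartedSpace (EuclideanSpace ℝ (Fin 3)) Z₂]
    (hS : νS.IsSurgery (𝓡 3) Z₂) {Dp Dm : EuclideanSpace ℝ (Fin 3) → Z}
    (F : Z ≃ₘ⟮𝓡 3, 𝓡 3⟯ Z) (ρp ρm : EuclideanSpace ℝ (Fin 3) ≃ₗᵢ[ℝ] EuclideanSpace ℝ (Fin 3))
    (hρm : ∀ x, ρm (ρm x) = x)
    (hFp : ∀ y : EuclideanSpace ℝ (Fin 3), ‖y‖ ≤ 1 →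
      F (νS.toFun () (⟨EuclideanSpace.single 0 1, single_mem_sphere_zero⟩, ρp y)) = Dp y)
    (hFm : ∀ y : EuclideanSpace ℝ (Fin 3), ‖y‖ ≤ 1 →
      F (νS.toFun () (⟨-EuclideanSpace.single 0 1, neg_single_mem_sphere_zero⟩, ρm y)) = Dm y)
    (A : TopologicalSpace.Opens Z) (hA : (A : Set Z) = ({Dp 0, Dm 0} : Set Z)ᶜ) :
    IsOpenGluing (𝓡 3) ((𝓡 0).prod ((𝓡 1).prod (𝓡 2))) (𝓡 3)
      (A := ↥A) (B := ↥(ballTimesSphere Unit 0 2)) (P := Z₂)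
      (fun a b => ∃ t : ℝ, t ∈ Set.Ioo (0 : ℝ) 1 ∧
        (((b : DiscreteIndex Unit × (EuclideanSpace ℝ (Fin 1) ×
              Metric.sphere (0 : EuclideanSpace ℝ (Fin 3)) 1)).2.1 = t • EuclideanSpace.single 0 1 ∧
            (a : Z) = Dp (t • ((b : DiscreteIndex Unit × (EuclideanSpace ℝ (Fin 1) ×
              Metric.sphere (0 : EuclideanSpace ℝ (Fin 3)) 1)).2.2 : EuclideanSpace ℝ (Fin 3)))) ∨
          ((b : DiscreteIndex Unit × (EuclideanSpace ℝ (Fin 1) ×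
              Metric.sphere (0 : EuclideanSpace ℝ (Fin 3)) 1)).2.1 = (-t) • EuclideanSpace.single 0 1 ∧
            (a : Z) = Dm (ρm (ρp (t • ((b : DiscreteIndex Unit × (EuclideanSpace ℝ (Fin 1) ×
              Metric.sphere (0 : EuclideanSpace ℝ (Fin 3)) 1)).2.2 : EuclideanSpace ℝ (Fin 3)))))))) := by
  -- the poles and the feet
  set vp : Metric.sphere (0 : EuclideanSpace ℝ (Fin 1)) 1 :=
    ⟨EuclideanSpace.single 0 1, single_mem_sphere_zero⟩ with hvp
  set vm : Metric.sphere (0 : EuclideanSpace ℝ (Fin 1)) 1 :=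
    ⟨-EuclideanSpace.single 0 1, neg_single_mem_sphere_zero⟩ with hvm
  -- the first piece: `F⁻¹ : A ≅ Z ∖ cores`
  have hcores : ∀ x : Z, x ∈ νS.cores ↔ x = F.symm (Dp 0) ∨ x = F.symm (Dm 0) := by
    intro x
    have hp0 : F (νS.toFun () (vp, 0)) = Dp 0 := by simpa using hFp 0 (by simp)
    have hm0 : F (νS.toFun () (vm, 0)) = Dm 0 := by simpa using hFm 0 (by simp)
    rw [FramedSphereFamily.mem_cores_iff]
    constructor
    · rintro ⟨j, w, rfl⟩
      obtain rfl : j = () := rfl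
      rw [FramedSphereFamily.sphere_apply]
      rcases sphere_zero_eq_or w with rfl | rfl
      · left
        rw [← hp0, Diffeomorph.symm_apply_apply]
      · right
        rw [← hm0, Diffeomorph.symm_apply_apply]
    · rintro (rfl | rfl)
      · exact ⟨(), vp, by rw [FramedSphereFamily.sphere_apply, ← hp0, Diffeomorph.symm_apply_apply]⟩
      · exact ⟨(), vm, by rw [FramedSphereFamily.sphere_apply, ← hm0, Diffeomorph.symm_apply_apply]⟩
  have hmemA : ∀ x : Z, F.symm x ∈ νS.complement ↔ x ∈ A := by
    intro x
    rw [FramedSphereFamily.mem_complement_iff, hcores, ← SetLike.mem_coe, hA, mem_compl_iff,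
      mem_insert_iff, mem_singleton_iff, EmbeddingLike.apply_eq_iff_eq, EmbeddingLike.apply_eq_iff_eq]
  obtain ⟨α, hα⟩ := exists_diffeomorph_opens F.symm A νS.complement hmemA
  -- the second piece: the symmetry `(i, y, u) ↦ (i, y, ρp u)`
  set Φ : (DiscreteIndex Unit × (EuclideanSpace ℝ (Fin 1) × Metric.sphere (0 : EuclideanSpace ℝ (Fin 3)) 1))
      ≃ₘ⟮(𝓡 0).prod ((𝓡 1).prod (𝓡 2)), (𝓡 0).prod ((𝓡 1).prod (𝓡 2))⟯
      (DiscreteIndex Unit × (EuclideanSpace ℝ (Fin 1) × Metric.sphere (0 : EuclideanSpace ℝ (Fin 3)) 1)) :=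
    (Diffeomorph.refl (𝓡 0) (DiscreteIndex Unit) ∞).prodCongr
      ((Diffeomorph.refl (𝓡 1) (EuclideanSpace ℝ (Fin 1)) ∞).prodCongr (sphereCongr (n := 2) ρp)) with hΦ
  have hΦ1 : ∀ q, (Φ q).2.1 = q.2.1 := fun q => rfl
  have hΦ2 : ∀ q, ((Φ q).2.2 : EuclideanSpace ℝ (Fin 3)) = ρp q.2.2 := fun q => coe_sphereCongr ρp q.2.2
  have hmemB : ∀ q, Φ q ∈ ballTimesSphere Unit 0 2 ↔ q ∈ ballTimesSphere Unit 0 2 := fun q => by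
    rw [mem_ballTimesSphere_iff, mem_ballTimesSphere_iff, hΦ1]
  obtain ⟨β, hβ⟩ := exists_diffeomorph_opens Φ (ballTimesSphere Unit 0 2) (ballTimesSphere Unit 0 2) hmemB
  -- transport and rewrite the relation
  refine (hS.comp_diffeomorph_pieces α β).of_forall_iff fun a b => ?_
  have hb1 : ((β b : ↥(ballTimesSphere Unit 0 2)) : DiscreteIndex Unit × (EuclideanSpace ℝ (Fin 1) ×
      Metric.sphere (0 : EuclideanSpace ℝ (Fin 3)) 1)).2.1 = (b : DiscreteIndex Unit ×
        (EuclideanSpace ℝ (Fin 1) × Metric.sphere (0 : EuclideanSpace ℝ (Fin 3)) 1)).2.1 := by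
    rw [hβ, hΦ1]
  have hb2 : (((β b : ↥(ballTimesSphere Unit 0 2)) : DiscreteIndex Unit × (EuclideanSpace ℝ (Fin 1) ×
      Metric.sphere (0 : EuclideanSpace ℝ (Fin 3)) 1)).2.2 : EuclideanSpace ℝ (Fin 3)) =
        ρp (b : DiscreteIndex Unit × (EuclideanSpace ℝ (Fin 1) ×
          Metric.sphere (0 : EuclideanSpace ℝ (Fin 3)) 1)).2.2 := by
    rw [hβ, hΦ2]
  have ha : ((α a : ↥νS.complement) : Z) = F.symm a := hα a
  set u : EuclideanSpace ℝ (Fin 3) := ((b : DiscreteIndex Unit × (EuclideanSpace ℝ (Fin 1) ×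
    Metric.sphere (0 : EuclideanSpace ℝ (Fin 3)) 1)).2.2 : EuclideanSpace ℝ (Fin 3)) with hu
  have hu1 : ‖u‖ = 1 := norm_eq_of_mem_sphere _
  have hnorm : ∀ {t : ℝ}, t ∈ Set.Ioo (0 : ℝ) 1 → ∀ (L : EuclideanSpace ℝ (Fin 3) ≃ₗᵢ[ℝ]
      EuclideanSpace ℝ (Fin 3)), ‖L (t • u)‖ ≤ 1 := fun {t} ht L => by
    rw [LinearIsometryEquiv.norm_map, norm_smul, hu1, mul_one, Real.norm_of_nonneg ht.1.le]
    exact ht.2.le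
  have hnorm' : ∀ {t : ℝ}, t ∈ Set.Ioo (0 : ℝ) 1 → ‖t • u‖ ≤ 1 := fun {t} ht => by
    simpa using hnorm ht (LinearIsometryEquiv.refl ℝ _)
  unfold sphereFamilySurgeryRel
  constructor
  · rintro ⟨w, θ, hθ, hbθ, haθ⟩
    rw [hb1] at hbθ
    rw [hb2, ha] at haθ
    refine ⟨θ, hθ, ?_⟩
    rcases sphere_zero_eq_or w with rfl | rfl
    · refine Or.inl ⟨hbθ, ?_⟩
      rw [← hFp (θ • u) (hnorm' hθ), LinearIsometryEquiv.map_smul, ← haθ, Diffeomorph.apply_symm_apply]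
    · refine Or.inr ⟨by rw [hbθ, smul_neg, neg_smul], ?_⟩
      rw [← hFm (ρm (ρp (θ • u))) (by rw [LinearIsometryEquiv.norm_map]; exact hnorm hθ ρp), hρm,
        LinearIsometryEquiv.map_smul, ← haθ, Diffeomorph.apply_symm_apply]
  · rintro ⟨t, ht, ⟨hbt, hat⟩ | ⟨hbt, hat⟩⟩
    · refine ⟨vp, t, ht, by rw [hb1, hbt], ?_⟩
      rw [hb2, ha, hat, ← hFp (t • u) (hnorm' ht), Diffeomorph.symm_apply_apply,
        LinearIsometryEquiv.map_smul]
    · refine ⟨vm, t, ht, by rw [hb1, hbt, smul_neg, neg_smul], ?_⟩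
      rw [hb2, ha, hat, ← hFm (ρm (ρp (t • u))) (by rw [LinearIsometryEquiv.norm_map]; exact hnorm ht ρp),
        hρm, Diffeomorph.symm_apply_apply, LinearIsometryEquiv.map_smul]

/-- **Normalisation of a `0`-surgery presentation onto two prescribed discs, up to one
reflection** (the unoriented disc theorem with compact support, Palais 1960, Thm. B / Hirsch 1976,
Ch. 8 §3, Thm. 3.1 and the remark after it, applied twice: once in `Z`, once in the connected open
submanifold `Z ∖ D₊(𝔻³)` and extended by the identity).  Let `Z₂` be the surgery of the connected
Hausdorff `3`-manifold `Z` along a framed `S⁰` (`νS.IsSurgery (𝓡 3) Z₂`), let `D₊, D₋ : ℝ³ ↪ Z` be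
discs with disjoint ranges, `r` an involutive linear isometry of `ℝ³` with `det r < 0`, and `A` the
open submanifold `Z ∖ {D₊ 0, D₋ 0}`.  Then for `ρ = id` or `ρ = r`, `Z₂` is the open gluing of `A`
and `D̊¹ × S²` along Milnor's identification `D₊ (t u) ∼ (t e₁, u)`, `D₋ (ρ (t u)) ∼ (-t e₁, u)`
(`0 < t < 1`, `u ∈ S²`). [cite: HirschDT1976, Ch. 8 §3, Thm. 3.1] [cite: Palais1960, Thm. B]
[cite: MilnorHCobordism1965, Def. 3.11] -/
theorem FramedSphereFamily.IsSurgery.exists_isOpenGluing_stdRel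
    {Z : Type u} [TopologicalSpace Z] [T2Space Z] [ConnectedSpace Z]
    [ChartedSpace (EuclideanSpace ℝ (Fin 3)) Z] [IsManifold (𝓡 3) ∞ Z]
    {νS : FramedSphereFamily (𝓡 3) Z Unit 0 3}
    {Z₂ : Type v} [TopologicalSpace Z₂] [ChartedSpace (EuclideanSpace ℝ (Fin 3)) Z₂]
    (hS : νS.IsSurgery (𝓡 3) Z₂) {Dp Dm : EuclideanSpace ℝ (Fin 3) → Z}
    (hDp : Manifold.IsSmoothEmbedding (𝓡 3) (𝓡 3) ∞ Dp)
    (hDm : Manifold.IsSmoothEmbedding (𝓡 3) (𝓡 3) ∞ Dm) (hdisj : Disjoint (range Dp) (range Dm))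
    (r : EuclideanSpace ℝ (Fin 3) ≃ₗᵢ[ℝ] EuclideanSpace ℝ (Fin 3))
    (hr : LinearMap.det (r.toLinearEquiv : EuclideanSpace ℝ (Fin 3) →ₗ[ℝ] EuclideanSpace ℝ (Fin 3)) < 0)
    (hrr : ∀ x, r (r x) = x) (A : TopologicalSpace.Opens Z)
    (hA : (A : Set Z) = ({Dp 0, Dm 0} : Set Z)ᶜ) :
    ∃ ρ : EuclideanSpace ℝ (Fin 3) ≃ₗᵢ[ℝ] EuclideanSpace ℝ (Fin 3),
      (ρ = LinearIsometryEquiv.refl ℝ (EuclideanSpace ℝ (Fin 3)) ∨ ρ = r) ∧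
      IsOpenGluing (𝓡 3) ((𝓡 0).prod ((𝓡 1).prod (𝓡 2))) (𝓡 3)
        (A := ↥A) (B := ↥(ballTimesSphere Unit 0 2)) (P := Z₂)
        (fun a b => ∃ t : ℝ, t ∈ Set.Ioo (0 : ℝ) 1 ∧
          (((b : DiscreteIndex Unit × (EuclideanSpace ℝ (Fin 1) ×
                Metric.sphere (0 : EuclideanSpace ℝ (Fin 3)) 1)).2.1 = t • EuclideanSpace.single 0 1 ∧
              (a : Z) = Dp (t • ((b : DiscreteIndex Unit × (EuclideanSpace ℝ (Fin 1) ×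
                Metric.sphere (0 : EuclideanSpace ℝ (Fin 3)) 1)).2.2 : EuclideanSpace ℝ (Fin 3)))) ∨
            ((b : DiscreteIndex Unit × (EuclideanSpace ℝ (Fin 1) ×
                Metric.sphere (0 : EuclideanSpace ℝ (Fin 3)) 1)).2.1 = (-t) • EuclideanSpace.single 0 1 ∧
              (a : Z) = Dm (ρ (t • ((b : DiscreteIndex Unit × (EuclideanSpace ℝ (Fin 1) ×
                Metric.sphere (0 : EuclideanSpace ℝ (Fin 3)) 1)).2.2 : EuclideanSpace ℝ (Fin 3))))))) := by
  have h3 : (3 : ℕ) ≠ 0 := by norm_num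
  -- the poles and the feet
  set vp : Metric.sphere (0 : EuclideanSpace ℝ (Fin 1)) 1 :=
    ⟨EuclideanSpace.single 0 1, single_mem_sphere_zero⟩ with hvp
  set vm : Metric.sphere (0 : EuclideanSpace ℝ (Fin 1)) 1 :=
    ⟨-EuclideanSpace.single 0 1, neg_single_mem_sphere_zero⟩ with hvm
  have hvpm : vp ≠ vm := by
    intro h
    have h1 := congrArg (fun w : Metric.sphere (0 : EuclideanSpace ℝ (Fin 1)) 1 =>
      (w : EuclideanSpace ℝ (Fin 1)) 0) h
    simp only [hvp, hvm, PiLp.neg_apply, PiLp.single_apply, if_true] at h1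
    norm_num at h1
  obtain ⟨hTpe, -⟩ := νS.isSmoothEmbedding_slice () vp
  obtain ⟨hTme, -⟩ := νS.isSmoothEmbedding_slice () vm
  have hTdisj : ∀ y y', νS.toFun () (vp, y) ≠ νS.toFun () (vm, y') := fun y y' h =>
    hvpm (congrArg Prod.fst (νS.injective () h))
  have hr' : LinearMap.det ((r.toContinuousLinearEquiv).toLinearEquiv :
      EuclideanSpace ℝ (Fin 3) →ₗ[ℝ] EuclideanSpace ℝ (Fin 3)) < 0 := hr
  -- Step 1: move the `+` foot onto `D₊` (or `D₊ ∘ r`) in `Z`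
  obtain ⟨f₁, -, hf₁⟩ := exists_diffeomorph_apply_disc_eq_or_reflect_cs (M := Z) h3 hTpe hDp
    r.toContinuousLinearEquiv hr'
  obtain ⟨ρp, hρp, hf₁'⟩ : ∃ ρp : EuclideanSpace ℝ (Fin 3) ≃ₗᵢ[ℝ] EuclideanSpace ℝ (Fin 3),
      (ρp = LinearIsometryEquiv.refl ℝ (EuclideanSpace ℝ (Fin 3)) ∨ ρp = r) ∧
      ∀ y : EuclideanSpace ℝ (Fin 3), ‖y‖ ≤ 1 → f₁ (νS.toFun () (vp, ρp y)) = Dp y := by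
    rcases hf₁ with h | h
    · exact ⟨LinearIsometryEquiv.refl ℝ _, Or.inl rfl, h⟩
    · exact ⟨r, Or.inr rfl, h⟩
  -- Step 2: move the `-` foot onto `D₋` (or `D₋ ∘ r`) inside `U = Z ∖ D₊(𝔻³)`, fixing `D₊(𝔻³)`
  have hDpo : IsOpen (range Dp) := isOpen_range_of_isSmoothEmbedding_disc hDp
  set U : TopologicalSpace.Opens Z :=
    ⟨(Dp '' Metric.closedBall (0 : EuclideanSpace ℝ (Fin 3)) 1)ᶜ,
      ((isCompact_closedBall _ _).image hDp.contMDiff.continuous).isClosed.isOpen_compl⟩ with hU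
  haveI : ConnectedSpace U :=
    connectedSpace_compl_image_closedBall ⟨hDp.isEmbedding, hDpo⟩ (by norm_num) U rfl
  have hmemU₂ : ∀ y, f₁ (νS.toFun () (vm, y)) ∈ U := fun y => by
    rintro ⟨x, hx, hx'⟩
    rw [mem_closedBall_zero_iff] at hx
    rw [← hf₁' x hx] at hx'
    exact hTdisj _ _ (f₁.injective hx')
  have hmemU₂' : ∀ y, Dm y ∈ U := fun y => by
    rintro ⟨x, -, hx'⟩
    exact Set.disjoint_left.1 hdisj (mem_range_self x) (hx' ▸ mem_range_self y)
  have hi₂ : Manifold.IsSmoothEmbedding (𝓡 3) (𝓡 3) ∞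
      (fun y => (⟨f₁ (νS.toFun () (vm, y)), hmemU₂ y⟩ : U)) :=
    isSmoothEmbedding_codRestrict_of_forall_mem (hTme.diffeomorph_comp f₁) U hmemU₂
  have hi₂' : Manifold.IsSmoothEmbedding (𝓡 3) (𝓡 3) ∞ (fun y => (⟨Dm y, hmemU₂' y⟩ : U)) :=
    isSmoothEmbedding_codRestrict_of_forall_mem hDm U hmemU₂'
  obtain ⟨f₂, hf₂s, hf₂⟩ := exists_diffeomorph_apply_disc_eq_or_reflect_cs (M := U) h3 hi₂ hi₂'
    r.toContinuousLinearEquiv hr'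
  obtain ⟨ρm, hρm, hρmi, hf₂'⟩ : ∃ ρm : EuclideanSpace ℝ (Fin 3) ≃ₗᵢ[ℝ] EuclideanSpace ℝ (Fin 3),
      (ρm = LinearIsometryEquiv.refl ℝ (EuclideanSpace ℝ (Fin 3)) ∨ ρm = r) ∧ (∀ x, ρm (ρm x) = x) ∧
      ∀ y : EuclideanSpace ℝ (Fin 3), ‖y‖ ≤ 1 →
        f₂ ⟨f₁ (νS.toFun () (vm, ρm y)), hmemU₂ _⟩ = ⟨Dm y, hmemU₂' y⟩ := by
    rcases hf₂ with h | h
    · exact ⟨LinearIsometryEquiv.refl ℝ _, Or.inl rfl, fun _ => rfl, h⟩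
    · exact ⟨r, Or.inr rfl, hrr, h⟩
  obtain ⟨K₂, hK₂c, hK₂⟩ := exists_isCompact_forall_eq_self_of_hasCompactFixedSupport hf₂s
  obtain ⟨F₂, hF₂U, hF₂off⟩ := OpensDiffeoExtension.exists_diffeomorph_extend U f₂ hK₂c hK₂
  have hF₂fix : ∀ y : EuclideanSpace ℝ (Fin 3), ‖y‖ ≤ 1 → F₂ (Dp y) = Dp y := fun y hy =>
    hF₂off _ fun ⟨x, _, hx⟩ => x.2 ⟨y, mem_closedBall_zero_iff.2 hy, hx.symm⟩
  -- Step 3: transport along `F = F₂ ∘ f₁`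
  have hglue := hS.isOpenGluing_stdRel_of_diffeomorph (Dp := Dp) (Dm := Dm) (f₁.trans F₂) ρp ρm hρmi
    (fun y hy => by rw [Diffeomorph.coe_trans, comp_apply, hf₁' y hy, hF₂fix y hy])
    (fun y hy => by
      rw [Diffeomorph.coe_trans, comp_apply]
      have h2 := hF₂U ⟨f₁ (νS.toFun () (vm, ρm y)), hmemU₂ _⟩
      rw [hf₂' y hy] at h2
      exact h2) A hA
  refine ⟨ρp.trans ρm, ?_, hglue.of_forall_iff fun a b => by
    simp only [LinearIsometryEquiv.coe_trans, comp_apply]⟩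
  rcases hρp with rfl | rfl <;> rcases hρm with rfl | rfl
  · exact Or.inl (by ext x; rfl)
  · exact Or.inr (by ext x; rfl)
  · exact Or.inr (by ext x; rfl)
  · exact Or.inl (LinearIsometryEquiv.ext fun x => by simp [hrr])

end Literature.Topology.FourManifolds
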